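import Literature.AlgebraicGeometry.Resolution.RankOneReductionProofs
import HarnessLib

/-!
# Novacoski–Spivakovsky's final step of §3.1, TRACKED: the new model lies in `R_p`

Topic: `Literature/AlgebraicGeometry/Resolution` (proofs only; no definitions, no named facts).
The two lifting steps of Novacoski–Spivakovsky's reduction of local uniformization to rank one
(arXiv:1204.4751v1, Cor. 2.17 with Lemma 2.15, and the final step of §3.1 with Lemmas 2.18,
2.19) as proved in `RankOneReductionProofs.lean` (`novacoskiSpivakovsky2014_cor217`,
`novacoskiSpivakovsky2014_step`), with ONE MORE CONCLUSION recorded: the finitely generated model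
`A' ⊇ A` produced by each step lies inside the local ring `A_p ⊆ K` of `A` at the centre `p` of
the coarse valuation `ν₁` — stated elementarily: every `x ∈ A'` is `a s⁻¹` with `a, s ∈ A` and
`ν₁(s) = 0` — (Lemma 2.15 (1) / Lemma 2.19: the lifted blowing ups are isomorphisms
at `p` — every new generator is a fraction whose denominator lies outside `p`). The proofs are
those of `RankOneReductionProofs.lean` verbatim; the inclusion is the auxiliary statement `h1`
they already establish on the way to `A'_{p'} = A_p`.

Use (Cossart–Piltant 2019, proof of Prop. 4.8): for the extension `v̂` of a rank-one valuation
`v` of `K = Frac A` to a formal branch `K̂₁ = Frac(Â/P̂₁)`, composite of its `K`-bounded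
coarsening `ν₁` (centre `p = P∞`, the prime of `K`-infinitesimal elements) and a residual
valuation, the tracked steps produce a regular model of `Â/P̂₁` at `v̂` whose generators have
denominators outside `P∞`, i.e. `K`-finite denominators — the model `𝒪_{Ŷ,ŷ}`, "`Ŷ → Spec Â` an
isomorphism above `Spec Â_g`", consumed by `exists_adjoin_isRegularLocalRing_of_model`.

* `novacoskiSpivakovsky2014_cor217_tracked` — Cor. 2.17 with `A' ⊆ A_p`
  (`RankOneReductionTrackedLift.lean`);
* `novacoskiSpivakovsky2014_step_tracked` — §3.1 final step with `A' ⊆ A_p` (this file).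

## Source

* J. Novacoski, M. Spivakovsky, *Reduction of local uniformization to the rank one case*,
  EMS Ser. Congr. Rep. (2014); arXiv:1204.4751v1: Lemma 2.15, Cor. 2.17, Lemmas 2.18, 2.19,
  §3.1. [NovacoskiSpivakovsky2014]
-/

noncomputable section

open IsLocalRing

namespace Literature.AlgebraicGeometry.Resolution

universe u v

section tracked

variable {k : Type u} {K : Type v} [CommRing k] [Field K] [Algebra k K]

/-- Membership in the centre: `a ∈ m_O ∩ A ↔ ν(a) < 1`. [folklore] -/
private theorem mem_centre_iff_lt_one (O : ValuationSubring K) (A : Subalgebra k K)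
    (h : A.toSubring ≤ O.toSubring) (a : A.toSubring) :
    a ∈ ((maximalIdeal O).comap (Subring.inclusion h)) ↔ O.valuation a < 1 := by
  rw [Ideal.mem_comap, ValuationSubring.valuation_lt_one_iff]
  rfl

/-- **Novacoski–Spivakovsky 2014, §3.1, final step of the proof of Thm. 1.1** (pp. 14–15, with
Lemma 2.18 — numerators of a regular system of parameters of `R_p` — and Lemma 2.19 — the
blowing up along `(a, y_1, …, y_r)` keeps `R/p` and `R_p`): "Replacing `R` by `R⁽ᵐ⁾`, we may
assume that both `R_p` and `R/p` are regular. […] We proceed as before with `a_k` for all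
`k = 2, …, s` until we reach a local ring `R⁽ˢ⁾` […]. Therefore, `R⁽ˢ⁾` is regular." I.e. for a
Noetherian local domain `(R, m)` dominated by `ν = ν₁ ∘ ν₂` with `p` the centre of `ν₁`: if `R_p`
and `R/p` are regular, a finite sequence of local blowing ups with respect to `ν` ends in a
regular local ring. PROVED here for affine models `A ⊆ O` of `K` over a Noetherian base ring `k`
(`O ≤ O₁`); see the module docstring for the affine translation and the
(inessential) shortcut `h_k = 0`, one blowing up along `(∏ a_k, y)`. TRACKED form (this file):
the conclusion also records `A' ⊆ A_p` inside `K` — the one blowing up is along `(a, Y)` with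
`a ∉ p` of least value, so its chart is `A[y/a : y ∈ Y]` (Lemma 2.19: it keeps `R_p`).
[cite: NovacoskiSpivakovsky2014, §3.1 (proof of Thm. 1.1) with Lemma 2.19] -/
theorem novacoskiSpivakovsky2014_step_tracked [IsNoetherianRing k] (O O₁ : ValuationSubring K)
    (hO : O ≤ O₁)
    (A : Subalgebra k K) (hA : A.toSubring ≤ O.toSubring) (hAfg : A.FG)
    (hfrac : IsFractionRing A K)
    (hregP : IsRegularLocalRing
      (Localization.AtPrime ((maximalIdeal O₁).comap (Subring.inclusion (hA.trans hO)))))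
    (hregQ : IsRegularLocalRing
      (Localization.AtPrime ((maximalIdeal O).comap (Subring.inclusion hA)) ⧸
        ((maximalIdeal O₁).comap (Subring.inclusion (hA.trans hO))).map
          (algebraMap A.toSubring
            (Localization.AtPrime ((maximalIdeal O).comap (Subring.inclusion hA)))))) :
    ∃ (A' : Subalgebra k K) (hA' : A'.toSubring ≤ O.toSubring), A ≤ A' ∧ A'.FG ∧
      IsRegularLocalRing
        (Localization.AtPrime ((maximalIdeal O).comap (Subring.inclusion hA'))) ∧
      (∀ x ∈ A', ∃ a ∈ A, ∃ s ∈ A, O₁.valuation s = 1 ∧ x = a * s⁻¹) := by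
  classical
  haveI : IsFractionRing A.toSubring K := hfrac
  haveI hnoeth : IsNoetherianRing A.toSubring := isNoetherianRing_of_fg hAfg
  have hAO₁ : A.toSubring ≤ O₁.toSubring := hA.trans hO
  set P := ((maximalIdeal O₁).comap (Subring.inclusion hAO₁)) with hPdef
  set Q := ((maximalIdeal O).comap (Subring.inclusion hA)) with hQdef
  have hPQ : P ≤ Q := centre_mono O O₁ hO A hA
  -- Step 1 (Lemma 2.18): `Y ⊆ P` finite, generating `P A_P`, with `#Y ≤ dim A_P`.
  let AP := Localization.AtPrime P
  haveI : IsRegularLocalRing AP := hregP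
  obtain ⟨sP, hsPcard, hsPspan⟩ :=
    Submodule.FG.exists_span_finset_card_eq_spanFinrank
      (IsNoetherian.noetherian (maximalIdeal AP))
  have hnum : ∀ g : AP, ∃ y : A.toSubring, ∃ s : P.primeCompl,
      g * algebraMap A.toSubring AP s = algebraMap A.toSubring AP y := by
    intro g
    obtain ⟨⟨y, s⟩, h⟩ := IsLocalization.surj P.primeCompl g
    exact ⟨y, s, h⟩
  choose num den hnumden using hnum
  let Y : Finset A.toSubring := sP.image num
  have hYP : ∀ y ∈ Y, y ∈ P := by
    intro y hy
    obtain ⟨g, hg, rfl⟩ := Finset.mem_image.mp hy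
    rw [← IsLocalization.AtPrime.to_map_mem_maximal_iff AP P, ← hnumden g]
    apply Ideal.mul_mem_right
    rw [← hsPspan]
    exact Submodule.subset_span hg
  set IY : Ideal A.toSubring := Ideal.span (Y : Set A.toSubring) with hIYdef
  have hIYmap : IY.map (algebraMap A.toSubring AP) = maximalIdeal AP := by
    apply le_antisymm
    · rw [Ideal.map_le_iff_le_comap, hIYdef, Ideal.span_le]
      intro y hy
      rw [SetLike.mem_coe, Ideal.mem_comap, IsLocalization.AtPrime.to_map_mem_maximal_iff AP P]
      exact hYP y hy
    · rw [← hsPspan, Ideal.span_le]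
      intro g hg
      have hu : IsUnit (algebraMap A.toSubring AP (den g)) :=
        IsLocalization.map_units AP (den g)
      rw [SetLike.mem_coe, ← Ideal.unit_mul_mem_iff_mem _ hu, mul_comm, hnumden g]
      apply Ideal.mem_map_of_mem
      apply Ideal.subset_span
      exact Finset.mem_image_of_mem num hg
  have hYcard : Y.card ≤ (maximalIdeal AP).spanFinrank :=
    hsPcard ▸ Finset.card_image_le
  -- Step 2: `a ∉ P` with `a P ⊆ (Y)`.
  have hclear : ∀ z : A.toSubring, z ∈ P → ∃ m ∈ P.primeCompl, m * z ∈ IY := by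
    intro z hz
    rw [← IsLocalization.algebraMap_mem_map_algebraMap_iff P.primeCompl AP, hIYmap,
      IsLocalization.AtPrime.to_map_mem_maximal_iff AP P]
    exact hz
  choose m hm hmz using hclear
  obtain ⟨sgen, hsgen⟩ := IsNoetherian.noetherian (R := A.toSubring) (M := A.toSubring) P
  let m' : A.toSubring → A.toSubring := fun z => if hz : z ∈ P then m z hz else 1
  let a : A.toSubring := ∏ z ∈ sgen, m' z
  have hsgenP : ∀ z ∈ sgen, z ∈ P := fun z hz => hsgen ▸ Ideal.subset_span hz
  have haP : a ∈ P.primeCompl := by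
    apply prod_mem
    intro z hz
    simp only [m', dif_pos (hsgenP z hz)]
    exact hm z _
  have hamul : ∀ z ∈ P, a * z ∈ IY := by
    have h : Ideal.span {a} * P ≤ IY := by
      rw [← hsgen, Ideal.span_mul_span, Ideal.span_le]
      rintro _ ⟨x, hx, z, hz, rfl⟩
      rw [Set.mem_singleton_iff.mp hx]
      change (∏ z ∈ sgen, m' z) * z ∈ IY
      rw [← Finset.mul_prod_erase sgen m' hz, mul_comm (m' z), mul_assoc]
      apply Ideal.mul_mem_left
      simp only [m', dif_pos (hsgenP z hz)]
      exact hmz z _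
    exact fun z hz => Ideal.span_singleton_mul_le_iff.mp h z hz
  have ha1 : O₁.valuation (a : K) = 1 := (mem_primeCompl_centre_iff O₁ A hAO₁ a).mp haP
  have ha0 : (a : K) ≠ 0 := by intro h; rw [h, map_zero] at ha1; exact zero_ne_one ha1
  -- Step 3: the blowing up `A' = A[y/a : y ∈ Y]` along `(a, Y)`.
  let w₀ : A.toSubring → K := fun y => (y : K) / (a : K)
  have hw₀val : ∀ y ∈ Y, O₁.valuation (w₀ y) < 1 := by
    intro y hy
    have := (mem_centre_iff_lt_one O₁ A hAO₁ y).mp (hYP y hy)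
    simp only [w₀, map_div₀, ha1, div_one]
    exact this
  have hw₀O₁ : ∀ y ∈ Y, w₀ y ∈ O₁ := fun y hy =>
    (O₁.valuation_le_one_iff _).mp (hw₀val y hy).le
  have hw₀O : ∀ y ∈ Y, w₀ y ∈ O := by
    intro y hy
    apply mem_of_mem_maximalIdeal_of_le O O₁ hO ⟨w₀ y, hw₀O₁ y hy⟩
    rw [ValuationSubring.valuation_lt_one_iff]
    exact hw₀val y hy
  let W : Finset K := Y.image w₀
  let A' : Subalgebra k K := A ⊔ Algebra.adjoin k (W : Set K)
  have hk : ∀ c : k, algebraMap k K c ∈ O := fun c => hA (A.algebraMap_mem c)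
  have hA'O : A'.toSubring ≤ O.toSubring := by
    have : A' ≤ ({ O.toSubring with algebraMap_mem' := hk } : Subalgebra k K) := by
      refine sup_le (fun x hx => hA hx) (Algebra.adjoin_le ?_)
      intro x hx
      rw [Finset.coe_image] at hx
      obtain ⟨y, hy, rfl⟩ := hx
      exact hw₀O y hy
    exact fun x hx => this hx
  have hAA' : A ≤ A' := le_sup_left
  have hA'fg : A'.FG := hAfg.sup ⟨_, rfl⟩
  have hA'O₁ : A'.toSubring ≤ O₁.toSubring := hA'O.trans hO
  haveI hfrac' : IsFractionRing A'.toSubring K := isFractionRing_subalgebra_of_le A A' hAA'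
  haveI hnoeth' : IsNoetherianRing A'.toSubring := isNoetherianRing_of_fg hA'fg
  have hwA' : ∀ y ∈ Y, w₀ y ∈ A' := by
    intro y hy
    apply (le_sup_right : Algebra.adjoin k (W : Set K) ≤ A')
    apply Algebra.subset_adjoin
    rw [Finset.coe_image]
    exact ⟨y, hy, rfl⟩
  set P' := ((maximalIdeal O₁).comap (Subring.inclusion hA'O₁)) with hP'def
  set Q' := ((maximalIdeal O).comap (Subring.inclusion hA'O)) with hQ'def
  have hP'Q' : P' ≤ Q' := centre_mono O O₁ hO A' hA'O
  let incl : A.toSubring →+* A'.toSubring := Subring.inclusion fun x hx => hAA' hx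
  have hinclP : ∀ c : A.toSubring, incl c ∈ P' ↔ c ∈ P := fun c => Iff.rfl
  have hinclQ : ∀ c : A.toSubring, incl c ∈ Q' ↔ c ∈ Q := fun c => Iff.rfl
  -- the ideal `J' = (y/a : y ∈ Y) A'`
  let w : Y → A'.toSubring := fun y => ⟨w₀ y, hwA' y y.2⟩
  set J' : Ideal A'.toSubring := Ideal.span (Set.range w) with hJ'def
  have hJ'P' : J' ≤ P' := by
    rw [hJ'def, Ideal.span_le]
    rintro _ ⟨y, rfl⟩
    rw [SetLike.mem_coe, mem_centre_iff_lt_one]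
    exact hw₀val y y.2
  -- `P ⊆ J'`
  have hincl_y : ∀ y : Y, incl y = incl a * w y := by
    intro y
    apply Subtype.ext
    change ((y : A.toSubring) : K) = (a : K) * (((y : A.toSubring) : K) / (a : K))
    field_simp
  have hPJ' : ∀ z ∈ P, incl z ∈ J' := by
    intro z hz
    have h1 : incl (a * z) ∈ Ideal.span {incl a} * J' := by
      have : IY.map incl ≤ Ideal.span {incl a} * J' := by
        rw [hIYdef, Ideal.map_span, Ideal.span_le]
        rintro _ ⟨y, hy, rfl⟩
        rw [SetLike.mem_coe, show incl y = incl a * w ⟨y, hy⟩ from hincl_y ⟨y, hy⟩]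
        exact Ideal.mul_mem_mul (Ideal.mem_span_singleton_self _)
          (Ideal.subset_span ⟨⟨y, hy⟩, rfl⟩)
      exact this (Ideal.mem_map_of_mem _ (hamul z hz))
    rw [Ideal.mem_span_singleton_mul] at h1
    obtain ⟨b, hb, hab⟩ := h1
    rw [map_mul] at hab
    have ha0' : incl a ≠ 0 := by
      intro h; apply ha0
      exact congrArg Subtype.val h
    rw [← mul_left_cancel₀ ha0' hab]
    exact hb
  -- `A' = A + J'`
  have hdecomp : ∀ x : A'.toSubring, ∃ c : A.toSubring, x - incl c ∈ J' := by
    let T : Subalgebra k K :=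
      { carrier := {x | ∃ X : A'.toSubring, (X : K) = x ∧ ∃ c : A.toSubring, X - incl c ∈ J'}
        mul_mem' := by
          rintro _ _ ⟨X, rfl, c, hc⟩ ⟨X', rfl, c', hc'⟩
          refine ⟨X * X', rfl, c * c', ?_⟩
          have : X * X' - incl (c * c') = (X - incl c) * X' + incl c * (X' - incl c') := by
            rw [map_mul]; ring
          rw [this]
          exact J'.add_mem (J'.mul_mem_right _ hc) (J'.mul_mem_left _ hc')
        one_mem' := ⟨1, rfl, 1, by rw [map_one, sub_self]; exact J'.zero_mem⟩
        add_mem' := by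
          rintro _ _ ⟨X, rfl, c, hc⟩ ⟨X', rfl, c', hc'⟩
          refine ⟨X + X', rfl, c + c', ?_⟩
          have : X + X' - incl (c + c') = (X - incl c) + (X' - incl c') := by
            rw [map_add]; ring
          rw [this]
          exact J'.add_mem hc hc'
        zero_mem' := ⟨0, rfl, 0, by rw [map_zero, sub_self]; exact J'.zero_mem⟩
        algebraMap_mem' := fun c₀ => by
          refine ⟨⟨algebraMap k K c₀, A'.algebraMap_mem c₀⟩, rfl,
            ⟨algebraMap k K c₀, A.algebraMap_mem c₀⟩, ?_⟩
          have e : incl ⟨algebraMap k K c₀, A.algebraMap_mem c₀⟩ =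
              (⟨algebraMap k K c₀, A'.algebraMap_mem c₀⟩ : A'.toSubring) := Subtype.ext rfl
          rw [e, sub_self]; exact J'.zero_mem }
    have hA'T : A' ≤ T := by
      refine sup_le (fun x hx => ?_) (Algebra.adjoin_le fun x hx => ?_)
      · refine ⟨⟨x, hAA' hx⟩, rfl, ⟨x, hx⟩, ?_⟩
        have e : incl ⟨x, hx⟩ = (⟨x, hAA' hx⟩ : A'.toSubring) := Subtype.ext rfl
        rw [e, sub_self]; exact J'.zero_mem
      · rw [Finset.coe_image] at hx
        obtain ⟨y, hy, rfl⟩ := hx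
        exact ⟨w ⟨y, hy⟩, rfl, 0, by
          rw [map_zero, sub_zero]; exact Ideal.subset_span ⟨⟨y, hy⟩, rfl⟩⟩
    intro x
    obtain ⟨X, hX, c, hc⟩ := hA'T x.2
    have : X = x := Subtype.ext hX
    exact ⟨c, this ▸ hc⟩
  -- residues of `A'` are residues of `A` (Lemma 2.19 (i))
  have hres : ∀ x : A'.toSubring, ∃ c : A.toSubring,
      ((residue O₁).comp (Subring.inclusion hA'O₁)) x
          = ((residue O₁).comp (Subring.inclusion hAO₁)) c := by
    intro x
    obtain ⟨c, hc⟩ := hdecomp x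
    refine ⟨c, ?_⟩
    have h0 : ((residue O₁).comp (Subring.inclusion hA'O₁)) (x - incl c) = 0 :=
      (residue_inclusion_eq_zero_iff O₁ A' hA'O₁ _).mpr (hJ'P' hc)
    rw [map_sub, sub_eq_zero] at h0
    exact h0
  -- `P' = J'`
  have hP'J' : P' = J' := by
    refine le_antisymm (fun z hz => ?_) hJ'P'
    obtain ⟨c, hc⟩ := hdecomp z
    have hc' : incl c ∈ P' := by
      have := P'.sub_mem hz (hJ'P' hc)
      rwa [sub_sub_cancel] at this
    have := J'.add_mem hc (hPJ' c ((hinclP c).mp hc'))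
    rwa [sub_add_cancel] at this
  -- tracking: `A' ⊆ A_P` (the new generators are `y/a` with `a ∉ P`)
  have h1 : (A' : Set K) ⊆ (Localization.subalgebra.ofField K
      ((maximalIdeal O₁).comap (Subring.inclusion hAO₁)).primeCompl
      (Ideal.primeCompl_le_nonZeroDivisors _)) := by
    refine fun x hx => (sup_le (fun x hx => le_centreLocalization O₁ A hAO₁ hx)
      (Algebra.adjoin_le ?_) : A' ≤ { ((Localization.subalgebra.ofField K
          ((maximalIdeal O₁).comap (Subring.inclusion hAO₁)).primeCompl
          (Ideal.primeCompl_le_nonZeroDivisors _))).toSubring with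
        algebraMap_mem' := fun c =>
          le_centreLocalization O₁ A hAO₁ (A.algebraMap_mem c) }) hx
    intro x hx
    rw [Finset.coe_image] at hx
    obtain ⟨y, hy, rfl⟩ := hx
    change w₀ y ∈ (Localization.subalgebra.ofField K
        ((maximalIdeal O₁).comap (Subring.inclusion hAO₁)).primeCompl
        (Ideal.primeCompl_le_nonZeroDivisors _))
    rw [mem_centreLocalization_iff]
    exact ⟨y, y.2, a, a.2, ha1, div_eq_mul_inv _ _⟩
  -- `A'_{P'} = A_P` inside `K` (Lemma 2.19 (ii))
  have heq1 : ((Localization.subalgebra.ofField K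
      ((maximalIdeal O₁).comap (Subring.inclusion hA'O₁)).primeCompl
      (Ideal.primeCompl_le_nonZeroDivisors _)) : Set K)
      = (Localization.subalgebra.ofField K
      ((maximalIdeal O₁).comap (Subring.inclusion hAO₁)).primeCompl
      (Ideal.primeCompl_le_nonZeroDivisors _)) := by
    have h2 : (A : Set K) ⊆ (Localization.subalgebra.ofField K
        ((maximalIdeal O₁).comap (Subring.inclusion hA'O₁)).primeCompl
        (Ideal.primeCompl_le_nonZeroDivisors _)) :=
      fun x hx => le_centreLocalization O₁ A' hA'O₁ (hAA' hx)
    exact le_antisymm (centreLocalization_le O₁ A' A hA'O₁ hAO₁ h1)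
      (centreLocalization_le O₁ A A' hAO₁ hA'O₁ h2)
  have hdimP : ringKrullDim (Localization.AtPrime P') = ringKrullDim AP := by
    let e₁ := (IsLocalization.algEquiv P'.primeCompl (Localization.AtPrime P')
      ((Localization.subalgebra.ofField K
          ((maximalIdeal O₁).comap (Subring.inclusion hA'O₁)).primeCompl
          (Ideal.primeCompl_le_nonZeroDivisors _)))).toRingEquiv
    have heq' : ((Localization.subalgebra.ofField K
        ((maximalIdeal O₁).comap (Subring.inclusion hA'O₁)).primeCompl
        (Ideal.primeCompl_le_nonZeroDivisors _))).toSubring =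
        ((Localization.subalgebra.ofField K
            ((maximalIdeal O₁).comap (Subring.inclusion hAO₁)).primeCompl
            (Ideal.primeCompl_le_nonZeroDivisors _))).toSubring := SetLike.coe_injective heq1
    let e₂ : ((Localization.subalgebra.ofField K
        ((maximalIdeal O₁).comap (Subring.inclusion hA'O₁)).primeCompl
        (Ideal.primeCompl_le_nonZeroDivisors _)))
        ≃+* ((Localization.subalgebra.ofField K
        ((maximalIdeal O₁).comap (Subring.inclusion hAO₁)).primeCompl
        (Ideal.primeCompl_le_nonZeroDivisors _))) :=
      RingEquiv.subringCongr heq'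
    let e₃ := (IsLocalization.algEquiv P.primeCompl AP
        ((Localization.subalgebra.ofField K
        ((maximalIdeal O₁).comap (Subring.inclusion hAO₁)).primeCompl
        (Ideal.primeCompl_le_nonZeroDivisors _)))).toRingEquiv
    exact ringKrullDim_eq_of_ringEquiv (e₁.trans (e₂.trans e₃.symm))
  -- `A'_{Q'} / P' ≅ A_Q / P` is regular
  have hregSQ : IsRegularLocalRing (Localization.AtPrime Q' ⧸
      P'.map (algebraMap A'.toSubring (Localization.AtPrime Q'))) := by
    obtain ⟨θ, hθ⟩ := exists_centreResidueLift O O₁ hO A hA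
    obtain ⟨θ', hθ'⟩ := exists_centreResidueLift O O₁ hO A' hA'O
    have hrange := range_centreResidueLift_eq O O₁ hO A hA θ hθ A' hA'O hAA' θ' hθ' hres
    obtain ⟨e₁⟩ := nonempty_quotCentre_ringEquiv_range O O₁ hO A hA θ hθ
    obtain ⟨e₂⟩ := nonempty_quotCentre_ringEquiv_range O O₁ hO A' hA'O θ' hθ'
    have e : (Localization.AtPrime Q ⧸ P.map (algebraMap A.toSubring (Localization.AtPrime Q))) ≃+*
        (Localization.AtPrime Q' ⧸ P'.map (algebraMap A'.toSubring (Localization.AtPrime Q'))) :=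
      e₁.trans ((RingEquiv.subringCongr hrange.symm).trans e₂.symm)
    haveI := hregQ
    exact IsRegularLocalRing.of_ringEquiv
      (R := Localization.AtPrime Q ⧸ P.map (algebraMap A.toSubring (Localization.AtPrime Q))) e
  -- Step 4: `P'` is generated by `#Y ≤ dim A_P = dim A'_{P'}` elements; count dimensions.
  let Y' : Finset A'.toSubring := (Finset.univ : Finset Y).image w
  have hY' : P' = Ideal.span (Y' : Set A'.toSubring) := by
    rw [hP'J', hJ'def]
    congr 1
    simp only [Y', Finset.coe_image, Finset.coe_univ, Set.image_univ]
  have hY'card : (Y'.card : WithBot ℕ∞) ≤ ringKrullDim (Localization.AtPrime P') := by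
    rw [hdimP, ← IsRegularLocalRing.spanFinrank_maximalIdeal (R := AP)]
    have : Y'.card ≤ Y.card :=
      Finset.card_image_le.trans (by rw [Finset.card_univ, Fintype.card_coe])
    exact_mod_cast this.trans hYcard
  exact ⟨A', hA'O, hAA', hA'fg,
    isRegularLocalRing_localization_of_quotient P' Q' hP'Q' Y' hY' hY'card hregSQ,
    fun x hx => (mem_centreLocalization_iff O₁ A hAO₁ x).mp (h1 hx)⟩

end tracked

end Literature.AlgebraicGeometry.Resolution

end
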